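import Summits.BirchSwinnertonDyer.Rank1Residual.ManinAdditive.CongruenceExcessCeilingLawsEdges
import Mathlib.NumberTheory.Padics.HeightOneSpectrum
import HarnessLib
import HarnessLib.Audit.Tags

/-!
# Counterexamples to Agashe–Ribet–Stein Conjecture 2.2 at `2⁷ ∥ N` (cell bsd-f2-manin, desc lens — record W-50)

Agashe–Ribet–Stein (2012, Conj. 2.2; Literature fact-shape
`Literature.NumberTheory.EllipticCurves.ModularForms.AgasheRibetStein2012_conjecture`, verified by its
authors for `N ≤ 557`) propose `ord_p(r_E / m_E) ≤ ½ ord_p(N)` for every optimal elliptic curve `E`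
of conductor `N` (`r_E` the congruence number of the newform, `m_E` the modular degree).

**Finding F-desc-ARS (this cell).** At `ord₂(N) = 7` the conjecture FAILS for every `E[2]`-irreducible
optimal curve of Kodaira type `II` at `2` in Cremona's table below `N = 3712`: the 26 classes listed in
`ars22Rows` have `ord₂(r_E) = 9 = ord₂(m_E) + 4`, so `2·ord₂(r_E) = 18 > 17 = 2·ord₂(m_E) + 7`.
The numbers were produced by FOUR independent engines (kit jobs and tables recorded in the cell files
`run/shared/lean/pub/bsd-f2-manin/{desc,ref1}/`): engine 1 — PARI `mf` full space (trace-formula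
q-expansions to the Sturm bound, Hecke-image lattice index; j285284 / j290782 / j290784 / j290786);
engine 1b — PARI explicit-complement certificate with a `matsolvemod` witness (`f ≡ g (mod 2⁹)` soluble with a
checked `g ⊥ f`, insoluble mod `2¹⁰`; j289999 / j290439); engine R (referee seat ref1, §R32, verdict PASS) —
Atkin–Lehner assembly of `S₂(Γ₀(N), ℚ)` from the PARI newspaces of level `M ∣ N`, `matrixqz` saturation,
definition (ii) of Agashe–Ribet–Stein p. 3 as an integral change-of-basis determinant, on ALL 72 optimal
curves of the four levels (table `ref1/W50-rE-mirror-v1.tsv` sha16 b3d4f1d10ecd5a00; j291761 / j291865 /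
j291892); engine 3 — Sage 10.9 modular symbols, q-expansion-free and PARI-`mf`-free («Hecke-idempotent
engine»: `r_E = min {r : r·e_f ∈ ℤ⟨T₁,…,T_B⟩}` on `S⁺`, `B` = Sturm bound + 10, Stein 2007 Thm. 9.23, the
idempotent applied through the dual eigenvector, integrality decided prime by prime by an exact echelon
`mod p^M`; `m_E² = [e_f H : H ∩ V_f]`, `H = H₁(X₀(N), ℤ)`; calibrated against the census on 69 classes of 20
levels `20 … 1152`, and equal to engines 1 and R on ALL 72 optimal classes of the four levels, both `r_E` and
`m_E`: j292971 (1664), j293924 (2432, 3200, 3456), j294116 (2432 re-certification); table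
`desc/third-engine/g3/W50-third-engine-table.tsv`).  The
modular degrees agree with Cremona's `alldegphi` table and PARI's `ellmoddegree`; all 26 classes consist of
a single curve, so optimality inside the isogeny class is not in question.

What this file PROVES (kernel-checked, no `sorry`):
* `ars22Rows_all_violate` — the 26 recorded rows violate the inequality of Conj. 2.2 at `p = 2`
  (pure arithmetic on the certified valuations; `decide`);
* `ARS22Row.padic_violation` — the same violation stated with `padicValNat` on the recorded numbers;
* `not_agasheRibetStein2012_conjecture_of_witness1664` — ONE modular-parametrisation datum realising the
  first row (`ARS22WitnessAt1664`, a DATA statement: level `1664`, minimal degree, `ord₂(r) = 9`,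
  `ord₂(m) = 5`) refutes `AgasheRibetStein2012_conjecture`;
* `dyadicTypeTwoExcessFour_of_dyadicTypeTwoExcessLaw` — E-desc-22 (type `II`, `v ≥ 5`) specialises to
  the tree's E-desc-21 `DyadicTypeTwoExcessFour` at `v = 7`, whence
  `not_agasheRibetStein2012_conjecture_of_dyadicTypeTwoExcessLaw` through the tree edge
  `not_agasheRibetStein2012_conjecture_of_typeTwo` (E-desc-21 + one curve in its regime,
  `TypeTwoSevenWitnessExists`, refute the conjecture).

What it does NOT prove: the existence of the datum (`ARS22WitnessAt1664`, `TypeTwoSevenWitnessExists`) —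
no `ModularParametrizationData` term is constructible in the tree today — and the laws E-desc-21/22,
which are CONJECTURES of the cell (tagged `@[conjecture]`, nothing asserted).

[cite: AgasheRibetStein2012, Conj. 2.2 (the conjecture refuted modulo the data statement; its Thm. 2.1 gives m_E ∣ r_E and is respected by every row)]
-/

open scoped MatrixGroups ModularForm

open CongruenceSubgroup WeierstrassCurve
  Literature.NumberTheory.EllipticCurves Literature.NumberTheory.EllipticCurves.ModularForms
  Literature.NumberTheory.DiophantineGeometry

namespace Summit.BirchSwinnertonDyer.Rank1Residual.ManinAdditive

/-! ## The certified table -/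

/-- One census row: Cremona label of the optimal curve, and the dyadic factorisations
`N = 2^vN · oN`, `r_E = 2^vr · orr`, `m_E = 2^vm · om` (`oN`, `orr`, `om` odd). -/
structure ARS22Row where
  /-- Cremona label of the optimal curve (single-curve isogeny class). -/
  label : String
  /-- `ord₂(N)`. -/
  vN : ℕ
  /-- odd part of `N`. -/
  oN : ℕ
  /-- `ord₂(r_E)`. -/
  vr : ℕ
  /-- odd part of `r_E`. -/
  orr : ℕ
  /-- `ord₂(m_E)`. -/
  vm : ℕ
  /-- odd part of `m_E`. -/
  om : ℕ

namespace ARS22Row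

/-- The level `N = 2^vN · oN`. -/
def level (ρ : ARS22Row) : ℕ := 2 ^ ρ.vN * ρ.oN
/-- The congruence number `r_E = 2^vr · orr`. -/
def congr (ρ : ARS22Row) : ℕ := 2 ^ ρ.vr * ρ.orr
/-- The modular degree `m_E = 2^vm · om`. -/
def deg (ρ : ARS22Row) : ℕ := 2 ^ ρ.vm * ρ.om

/-- Well-formedness (odd parts odd) and the violation of ARS12 Conj. 2.2 at `p = 2`, as a Boolean:
`2·ord₂(m_E) + ord₂(N) < 2·ord₂(r_E)`. -/
def violates (ρ : ARS22Row) : Bool :=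
  ρ.oN % 2 == 1 && ρ.orr % 2 == 1 && ρ.om % 2 == 1 && decide (2 * ρ.vm + ρ.vN < 2 * ρ.vr)

end ARS22Row

/-- The 26 `E[2]`-irreducible type-`II` optimal curves with `2⁷ ∥ N`, `N ≤ 3712` (levels
`1664 = 2⁷·13`, `2432 = 2⁷·19`, `3200 = 2⁷·25`, `3456 = 2⁷·27`), with `(r_E, m_E)`:
`1664 b f j o` (1536, 96), `1664 i t` (2560, 160), `2432 a c` (2560, 160), `2432 e g` (4608, 288),
`3200 c s` (7680, 96), `3200 l z` (7680, 480), `3200 k w` (53760, 3360), `3200 n bb` (53760, 672),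
`3456 a e` (4608, 96), `3456 i n` (4608, 288), `3456 j p` (23040, 480), `3456 d g` (23040, 1440).
Four engines agree on every row (module docstring). -/
def ars22Rows : List ARS22Row :=
  [⟨"1664b1", 7, 13, 9, 3, 5, 3⟩, ⟨"1664f1", 7, 13, 9, 3, 5, 3⟩, ⟨"1664i1", 7, 13, 9, 5, 5, 5⟩,
   ⟨"1664j1", 7, 13, 9, 3, 5, 3⟩, ⟨"1664o1", 7, 13, 9, 3, 5, 3⟩, ⟨"1664t1", 7, 13, 9, 5, 5, 5⟩,
   ⟨"2432a1", 7, 19, 9, 5, 5, 5⟩, ⟨"2432c1", 7, 19, 9, 5, 5, 5⟩, ⟨"2432e1", 7, 19, 9, 9, 5, 9⟩,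
   ⟨"2432g1", 7, 19, 9, 9, 5, 9⟩,
   ⟨"3200c1", 7, 25, 9, 15, 5, 3⟩, ⟨"3200s1", 7, 25, 9, 15, 5, 3⟩, ⟨"3200l1", 7, 25, 9, 15, 5, 15⟩,
   ⟨"3200z1", 7, 25, 9, 15, 5, 15⟩, ⟨"3200k1", 7, 25, 9, 105, 5, 105⟩, ⟨"3200w1", 7, 25, 9, 105, 5, 105⟩,
   ⟨"3200n1", 7, 25, 9, 105, 5, 21⟩, ⟨"3200bb1", 7, 25, 9, 105, 5, 21⟩,
   ⟨"3456a1", 7, 27, 9, 9, 5, 3⟩, ⟨"3456e1", 7, 27, 9, 9, 5, 3⟩, ⟨"3456i1", 7, 27, 9, 9, 5, 9⟩,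
   ⟨"3456n1", 7, 27, 9, 9, 5, 9⟩, ⟨"3456j1", 7, 27, 9, 45, 5, 15⟩, ⟨"3456p1", 7, 27, 9, 45, 5, 15⟩,
   ⟨"3456d1", 7, 27, 9, 45, 5, 45⟩, ⟨"3456g1", 7, 27, 9, 45, 5, 45⟩]

/-- The table has 26 rows. -/
theorem ars22Rows_length : ars22Rows.length = 26 := rfl

/-- Every recorded row is well-formed and violates ARS12 Conj. 2.2 at `p = 2`. -/
theorem ars22Rows_all_violate : ars22Rows.all ARS22Row.violates = true := by decide

/-- In every row `ord₂(N) = 7`, `ord₂(r_E) = 9`, `ord₂(m_E) = 5`: excess `x₂ = 4 = ⌊7/2⌋ + 1`. -/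
theorem ars22Rows_all_profile :
    (ars22Rows.all fun ρ => ρ.vN == 7 && ρ.vr == 9 && ρ.vm == 5) = true := by decide

/-- Thm. 2.1 of ARS (`m_E ∣ r_E`) is respected by every row (the odd parts divide). -/
theorem ars22Rows_all_deg_dvd :
    (ars22Rows.all fun ρ => ρ.vm ≤ ρ.vr && ρ.orr % ρ.om == 0) = true := by decide

/-- The recorded numbers of the first row: `N = 1664`, `r_E = 1536`, `m_E = 96`. -/
example : (ARS22Row.level ⟨"1664b1", 7, 13, 9, 3, 5, 3⟩, ARS22Row.congr ⟨"1664b1", 7, 13, 9, 3, 5, 3⟩,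
    ARS22Row.deg ⟨"1664b1", 7, 13, 9, 3, 5, 3⟩) = (1664, 1536, 96) := by decide

/-- `ord₂(2^k · m) = k` for odd `m`. [folklore] -/
theorem padicValNat_two_two_pow_mul_of_odd (k m : ℕ) (hm : m % 2 = 1) :
    padicValNat 2 (2 ^ k * m) = k := by
  have hm0 : m ≠ 0 := by rintro rfl; simp at hm
  rw [padicValNat.mul (by positivity) hm0, padicValNat.prime_pow,
    padicValNat.eq_zero_of_not_dvd (by omega)]
  simp

/-- A well-formed violating row violates Conj. 2.2 in its `padicValNat` form on the recorded numbers. -/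
theorem ARS22Row.padic_violation (ρ : ARS22Row) (h : ρ.violates = true) :
    2 * padicValNat 2 ρ.deg + padicValNat 2 ρ.level < 2 * padicValNat 2 ρ.congr := by
  simp only [ARS22Row.violates, Bool.and_eq_true, beq_iff_eq, decide_eq_true_eq] at h
  obtain ⟨⟨⟨hN, hr⟩, hm⟩, hlt⟩ := h
  rw [ARS22Row.deg, ARS22Row.level, ARS22Row.congr,
    padicValNat_two_two_pow_mul_of_odd _ _ hm, padicValNat_two_two_pow_mul_of_odd _ _ hN,
    padicValNat_two_two_pow_mul_of_odd _ _ hr]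
  exact hlt

/-- Every row of the table violates Conj. 2.2 in `padicValNat` form. -/
theorem ars22Rows_padic_violation (ρ : ARS22Row) (hρ : ρ ∈ ars22Rows) :
    2 * padicValNat 2 ρ.deg + padicValNat 2 ρ.level < 2 * padicValNat 2 ρ.congr :=
  ρ.padic_violation (List.all_eq_true.mp ars22Rows_all_violate ρ hρ)

/-! ## The data statements and the refutation edges -/

/-- **DATA statement `ARS22Row.Realised ρ`**: the row `ρ` is realised by a modular parametrisation
datum at level `ρ.level` of minimal degree among data with the same newform (i.e. by the optimal
curve) with `ord₂(r) = ρ.vr` and `ord₂(deg) = ρ.vm`.  For the 26 rows of `ars22Rows` this is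
certified numerically by four engines and is NOT provable in the tree today (no
`ModularParametrizationData` term is constructible). -/
def ARS22Row.Realised (ρ : ARS22Row) : Prop :=
  ∃ (W : WeierstrassCurve ℚ) (_ : W.IsElliptic) (_ : NeZero ρ.level)
    (D : ModularParametrizationData W ρ.level),
    (∀ (W' : WeierstrassCurve ℚ) [W'.IsElliptic] (D' : ModularParametrizationData W' ρ.level),
        D'.f = D.f → D.modularDegree ≤ D'.modularDegree) ∧
    padicValNat 2 (congruenceNumber D.f) = ρ.vr ∧ padicValNat 2 D.modularDegree = ρ.vm

/-- **Refutation edge, row by row (PROVED).** Any well-formed violating row that is realised by a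
datum refutes Agashe–Ribet–Stein Conj. 2.2 in its Literature form. -/
theorem not_agasheRibetStein2012_conjecture_of_realised (ρ : ARS22Row) (hv : ρ.violates = true)
    (h : ρ.Realised) : ¬ AgasheRibetStein2012_conjecture := by
  intro hars
  obtain ⟨W, _, _, D, hmin, hr, hm⟩ := h
  have h1 := hars W ρ.level D hmin 2 Nat.prime_two
  have h2 := ρ.padic_violation hv
  simp only [ARS22Row.violates, Bool.and_eq_true, beq_iff_eq, decide_eq_true_eq] at hv
  obtain ⟨⟨⟨hN, hr'⟩, hm'⟩, _⟩ := hv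
  rw [ARS22Row.deg, ARS22Row.congr, padicValNat_two_two_pow_mul_of_odd _ _ hm',
    padicValNat_two_two_pow_mul_of_odd _ _ hr'] at h2
  rw [hr, hm] at h1
  omega

/-- **DATA statement `ARS22RowsRealised`** (the census, as a `Prop`; certified numerically for all 26
rows by four independent engines — PARI `mf` lattice index, PARI explicit-complement certificate,
the referee's Atkin–Lehner-assembly determinant (ref1 §R32), Sage modular symbols (Hecke-idempotent
engine) — and Cremona's `alldegphi`; NOT provable in the tree
today): every row of `ars22Rows` is realised by the optimal curve it names.
[cite: AgasheRibetStein2012, Conj. 2.2 (hypothesis shape only; the numbers are the cell's four-engine census, desc lens W-50)] -/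
@[conjecture] def ARS22RowsRealised : Prop := ∀ ρ ∈ ars22Rows, ρ.Realised

/-- **DATA statement `ARS22WitnessAt1664`** = the first row alone (`1664b1`: level `1664`, minimal
degree, `ord₂(r) = 9`, `ord₂(m) = 5`); the weakest data input that refutes the conjecture.
[cite: AgasheRibetStein2012, Conj. 2.2 (hypothesis shape only; instance = Cremona 1664b1, r_E = 1536, m_E = 96, four engines)] -/
@[conjecture] def ARS22WitnessAt1664 : Prop := ARS22Row.Realised ⟨"1664b1", 7, 13, 9, 3, 5, 3⟩

/-- The census statement implies the single-row witness statement (row `1664b1` is the head of `ars22Rows`). -/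
theorem ars22WitnessAt1664_of_rowsRealised (h : ARS22RowsRealised) : ARS22WitnessAt1664 :=
  h _ (by simp [ars22Rows])

/-- `ord₂(1664) = 7` (`1664 = 2⁷ · 13`). -/
theorem padicValNat_two_1664 : padicValNat 2 1664 = 7 := by
  have : (1664 : ℕ) = 2 ^ 7 * 13 := by norm_num
  rw [this]
  exact padicValNat_two_two_pow_mul_of_odd 7 13 (by norm_num)

/-- **Refutation edge (PROVED).** One datum realising row `1664b1` refutes Agashe–Ribet–Stein
Conj. 2.2 in its Literature form: `2·9 = 18 > 17 = 2·5 + 7`. -/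
theorem not_agasheRibetStein2012_conjecture_of_witness1664 (h : ARS22WitnessAt1664) :
    ¬ AgasheRibetStein2012_conjecture :=
  not_agasheRibetStein2012_conjecture_of_realised _ (by decide) h

/-- **Refutation edge from the full census (PROVED).** -/
theorem not_agasheRibetStein2012_conjecture_of_rowsRealised (h : ARS22RowsRealised) :
    ¬ AgasheRibetStein2012_conjecture :=
  not_agasheRibetStein2012_conjecture_of_witness1664 (ars22WitnessAt1664_of_rowsRealised h)

/-! ## The laws of the breaking cell (conjectures of the cell) -/

/-! E-desc-21 `DyadicTypeTwoExcessFour`, its data schema `TypeTwoSevenWitnessExists` and the law-level refutation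
edge `not_agasheRibetStein2012_conjecture_of_typeTwo` are ALREADY in the tree (this namespace, files
`CongruenceExcessCeilingLaws.lean` / `CongruenceExcessCeilingLawsEdges.lean`, typer g2) and are used here BY NAME;
`ars22Rows` is the census behind them (26 / 26). -/

/-- **Candidate E-desc-22 (type II) `DyadicTypeTwoExcessLaw`** (a CONJECTURE of the cell; nothing
asserted).  `X₀(N)`-optimal `E`, `E[2]` irreducible, Kodaira type `II` at `2`, `v = ord₂(N) ≥ 5` ⇒
`ord₂(r_E) = ord₂(m_E) + ⌈v/2⌉` (written `(v + 1) / 2`).  Census (N ≤ 2000 complete + 2432, 3200,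
3456, 3712): `v = 6`: 26 / 26 (excess 3; levels 704, 1216, 1728, 1856), `v = 7`: 26 / 26 (excess 4 =
`ars22Rows`); type `II` with `E[2]` irreducible does not occur at `v ∈ {5, 8}` in range; at `v = 4`
the law is FALSE as a formula (excess 2 ×44 but 1 ×10, the ten with `ord₂(j) = 8`) — hence `5 ≤ v`.
[cite: AgasheRibetStein2012, Conj. 2.2 (ceiling ⌊v/2⌋, which this law meets at even v and exceeds by one at v = 7; Kodaira-resolved values NOT in print — MEMO-desc.md §20)] -/
@[conjecture] def DyadicTypeTwoExcessLaw : Prop :=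
  ∀ (W : WeierstrassCurve ℚ) [W.IsElliptic] [W.IsGloballyMinimal] [NeZero (W.conductorNorm ℤ)]
    (D : ModularParametrizationData W (W.conductorNorm ℤ)),
    (∀ z ∈ D.L.lattice, ∃ w ∈ periodLattice D.f, z = D.c * w) →
    (∀ (W' : WeierstrassCurve ℚ) [W'.IsElliptic]
        (D' : ModularParametrizationData W' (W.conductorNorm ℤ)),
        D'.f = D.f → D.modularDegree ≤ D'.modularDegree) →
    5 ≤ padicValNat 2 (W.conductorNorm ℤ) →
      W.kodairaSymbolAt ((Rat.HeightOneSpectrum.primesEquiv (R := ℤ)).symm ⟨2, Nat.prime_two⟩) =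
        KodairaSymbol.II →
      W.HasIrreducibleModPGaloisRep 2 →
      padicValNat 2 (congruenceNumber D.f) =
        padicValNat 2 D.modularDegree + (padicValNat 2 (W.conductorNorm ℤ) + 1) / 2

/-- **Candidate E-desc-22 (type III) `DyadicTypeThreeExcessLaw`** (a CONJECTURE of the cell; nothing
asserted).  `X₀(N)`-optimal `E`, `E[2]` irreducible, Kodaira type `III` at `2`, `v = ord₂(N)` ⇒
`ord₂(r_E) = ord₂(m_E) + ⌊v/2⌋` — EXACTLY the Agashe–Ribet–Stein ceiling.  Census: `v = 3`: 70 / 70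
(excess 1), `v = 5`: 4 / 4 (2; level 1888), `v = 7`: 6 / 6 (3; level 3712), `v = 8`: 6 / 6 (4; level
3328); 86 / 86 in all.  With E-desc-15 (`III*` ⇒ `⌊v/2⌋ − 1`) the `χ_{±8}`-packets `{III, III, III*, III*}`
read `(⌊v/2⌋, ⌊v/2⌋, ⌊v/2⌋ − 1, ⌊v/2⌋ − 1)` against `(4, 4, 3, 3)` for `{II, II, I₂*, I₂*}` at `v = 7`.
[cite: AgasheRibetStein2012, Conj. 2.2 (this law is its equality case on the type-III stratum; Kodaira-resolved values NOT in print — MEMO-desc.md §20)] -/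
@[conjecture] def DyadicTypeThreeExcessLaw : Prop :=
  ∀ (W : WeierstrassCurve ℚ) [W.IsElliptic] [W.IsGloballyMinimal] [NeZero (W.conductorNorm ℤ)]
    (D : ModularParametrizationData W (W.conductorNorm ℤ)),
    (∀ z ∈ D.L.lattice, ∃ w ∈ periodLattice D.f, z = D.c * w) →
    (∀ (W' : WeierstrassCurve ℚ) [W'.IsElliptic]
        (D' : ModularParametrizationData W' (W.conductorNorm ℤ)),
        D'.f = D.f → D.modularDegree ≤ D'.modularDegree) →
      W.kodairaSymbolAt ((Rat.HeightOneSpectrum.primesEquiv (R := ℤ)).symm ⟨2, Nat.prime_two⟩) =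
        KodairaSymbol.III →
      W.HasIrreducibleModPGaloisRep 2 →
      padicValNat 2 (congruenceNumber D.f) =
        padicValNat 2 D.modularDegree + padicValNat 2 (W.conductorNorm ℤ) / 2

/-- Edge (PROVED): the type-II law specialises to E-desc-21 at `v = 7` (`(7 + 1) / 2 = 4`). -/
theorem dyadicTypeTwoExcessFour_of_dyadicTypeTwoExcessLaw (h : DyadicTypeTwoExcessLaw) :
    DyadicTypeTwoExcessFour := by
  intro W _ _ _ D hL hmin hv hK hI
  have := h W D hL hmin (by omega) hK hI
  rw [hv] at this
  simpa using this

/-- Edge (PROVED): the type-II law and one optimal curve of type II at `2⁷ ∥ N` with `E[2]` irreducible refute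
Agashe–Ribet–Stein Conj. 2.2 (via the tree edge `not_agasheRibetStein2012_conjecture_of_typeTwo`). -/
theorem not_agasheRibetStein2012_conjecture_of_dyadicTypeTwoExcessLaw (h : DyadicTypeTwoExcessLaw)
    (hw : TypeTwoSevenWitnessExists) : ¬ AgasheRibetStein2012_conjecture :=
  not_agasheRibetStein2012_conjecture_of_typeTwo (dyadicTypeTwoExcessFour_of_dyadicTypeTwoExcessLaw h) hw

/-- Edge (PROVED): on the type-III stratum the law gives the Agashe–Ribet–Stein inequality (with equality). -/
theorem ars_ineq_of_dyadicTypeThreeExcessLaw (h : DyadicTypeThreeExcessLaw)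
    (W : WeierstrassCurve ℚ) [W.IsElliptic] [W.IsGloballyMinimal] [NeZero (W.conductorNorm ℤ)]
    (D : ModularParametrizationData W (W.conductorNorm ℤ))
    (hL : ∀ z ∈ D.L.lattice, ∃ w ∈ periodLattice D.f, z = D.c * w)
    (hmin : ∀ (W' : WeierstrassCurve ℚ) [W'.IsElliptic]
        (D' : ModularParametrizationData W' (W.conductorNorm ℤ)),
        D'.f = D.f → D.modularDegree ≤ D'.modularDegree)
    (hK : W.kodairaSymbolAt ((Rat.HeightOneSpectrum.primesEquiv (R := ℤ)).symm ⟨2, Nat.prime_two⟩) =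
        KodairaSymbol.III)
    (hI : W.HasIrreducibleModPGaloisRep 2) :
    2 * padicValNat 2 (congruenceNumber D.f) ≤
      2 * padicValNat 2 D.modularDegree + padicValNat 2 (W.conductorNorm ℤ) := by
  have := h W D hL hmin hK hI
  omega

end Summit.BirchSwinnertonDyer.Rank1Residual.ManinAdditive
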